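import Summits.ValiantsHypothesis.ValiantsHypothesis.Theses.ProofCarryingSymmetry

/-! Sketch for crux idea `pfaffial-parity` (strategist s7, negation lens) on `RestorationQP`.
`skewProdSq n = det(X - Xᵀ) * ∏_{i<j} (x_ij - x_ji)^2 = T_n^2` where `T_n = ± Pf(X - Xᵀ) * ∏_{i<j}(x_ij - x_ji)`
is a diagonally `S_n`-invariant VP polynomial (n even) NOT covered by Ω-doubling (parity obstruction).
`PfaffialRestorable` = "some polynomial square root of `skewProdSq n` has quasi-polynomial symmetric circuits";
it follows from `RestorationQP` (T_n ∈ VP ∩ Inv) and its refutation would refute the crux. -/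

open MvPolynomial

namespace Summit.ValiantsHypothesis.ValiantsHypothesis.Cruxes.RestorationQP.PfaffialParity

open Literature.Computability.AlgebraicComplexity

/-- `det(X - Xᵀ) · ∏_{i<j} (x_ij - x_ji)²`, the square of the Pfaffial candidate `T_n`. -/
noncomputable def skewProdSq (n : ℕ) : MvPolynomial (Fin n × Fin n) ℂ :=
  ((Matrix.mvPolynomialX (Fin n) (Fin n) ℂ) - (Matrix.mvPolynomialX (Fin n) (Fin n) ℂ).transpose).det *
    ∏ i : Fin n, ∏ j : Fin n, (if i < j then (X (i, j) - X (j, i)) ^ 2 else 1)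

/-- First lemma of the idea (restoration form): a polynomial square root of `skewProdSq n` — i.e. `± T_n` —
has `S_n`-symmetric circuits of quasi-polynomial size, uniformly in `n`. A consequence of `RestorationQP`;
open; not reachable by the identities (I1)–(I4) of STRATEGY-CENSUS-s7 §Negation. -/
def PfaffialRestorable : Prop :=
  ∃ c : ℕ, ∀ n : ℕ, ∃ (G : Type) (_ : Fintype G) (C : LabelledArithCircuit ℂ (Fin n × Fin n) Unit G),
    C.IsSymmetric (Equiv.Perm (Fin n)) ∧ (C.eval (C.output ())) ^ 2 = skewProdSq n ∧
      Fintype.card G ≤ 2 ^ ((Nat.log 2 n + c) ^ c)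

end Summit.ValiantsHypothesis.ValiantsHypothesis.Cruxes.RestorationQP.PfaffialParity
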